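import Mathlib
import Summits.MatrixMultiplication.MatrixMultiplication.Theorems.SnSubsetDichotomyPolynomialSlackPositionKeptBoundFarInst
import Summits.MatrixMultiplication.MatrixMultiplication.Theorems.SnSubsetDichotomyPolynomialSlackSubuniformKept

/-!
# The kept value of a hub row, full column (3/4 step)

Crux `Summit.MatrixMultiplication.MatrixMultiplication.Theses.SnSubsetDichotomy.PolynomialSlack`
(item `stmt-MatrixMultiplication-8306`), level-one programme, line transport-split-hull (lead c10).
At a hub row `k` (a U-position) of the sparse profile `dC`, with the hub columns `Qm` masked out, the
kept value of the FULL column `dB(·,k)` against the masked heavy row,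
`kept_k = (n-1) Σ_{i ∉ Qm} pC(k,i) Σ_j dB(j,k) (1/n - dA(i,j))`, is at most `5/8` of the entropy cost
of the included levels plus slop.  Proof: `dB = pB + w` with `pB` the heavy part at threshold
`θB = 16/n` and `w` the sub-uniform weight; the `pB`-part is `position_kept_bound_far_inst` (with
`θB := 16/n`), the `w`-part is `subuniform_kept_le` (its hypothesis `hbig` follows from the no-pinned-S-win
fact (2) of `atom_noWin_facts_masked` and `32 ≤ ε₁ n^{0.245}`), and
`Σ_j dB (1/n - dA) = [(Σ_j pB)/n - Σ_j dA pB] + Σ_j w (1/n - dA)` termwise (`Σ_j (1/n)·pB = (Σ pB)/n`).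
-/

namespace Summit.MatrixMultiplication.MatrixMultiplication.Theorems.PolynomialSlack

open scoped BigOperators
open Literature.Combinatorics.Additive (TripleProductProperty)

set_option linter.dupNamespace false

/-- **Kept value of a hub row (full column, masked row), at most `5/8` of the cost.** [folklore] -/
theorem hubRow_kept_le {n : ℕ} (hn : 2 ≤ n) (B : ℕ) (hB : ∀ S' T' U' : Finset (Equiv.Perm (Fin (n - 1))), TripleProductProperty S' T' U' → S'.card * T'.card * U'.card ≤ B) {S T U : Finset (Equiv.Perm (Fin n))} (hTPP : TripleProductProperty S T U) (hS0 : S.Nonempty) (hT0 : T.Nonempty) (hU0 : U.Nonempty) (dA dB dC pB pC : Fin n → Fin n → ℝ) (hdA : ∀ i j, dA i j = (((S ×ˢ T).filter fun st => st.2 j = st.1 i).card : ℝ) / (S.card * T.card : ℕ)) (hdB : ∀ j k, dB j k = (((T ×ˢ U).filter fun tu => tu.2 k = tu.1 j).card : ℝ) / (T.card * U.card : ℕ)) (hdC : ∀ k i, dC k i = (((U ×ˢ S).filter fun us => us.2 i = us.1 k).card : ℝ) / (U.card * S.card : ℕ)) (θC : ℝ) (hθC : 16 / (n : ℝ) ≤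 θC) (hpB : ∀ j k, pB j k = if 16 / (n : ℝ) ≤ dB j k then dB j k - 1 / n else 0) (hpC : ∀ k i, pC k i = if θC ≤ dC k i then dC k i - 1 / n else 0) (ε₁ ε₂ h₁ M A₀ P W A₁ : ℝ) (hε₁ : 0 < ε₁) (hε₂ : 0 < ε₂) (hε₂1 : ε₂ ≤ 1) (hε₁n : 32 ≤ ε₁ * (n : ℝ) ^ (245 / 1000 : ℝ)) (hh₁ : 0 < h₁) (hP0 : 0 ≤ P) (hM : 56 * (((⌊Real.logb 2 ((n : ℝ) ^ 2)⌋₊ + 1 : ℕ) : ℝ) * ((⌊Real.logb 2 ((n : ℝ) ^ 2)⌋₊ + 1 : ℕ) : ℝ)) ≤ M) (hA₀ : 5000 * n * (1 + Real.log n) * Real.log (4 * ((n.factorial : ℝ) / (S.card * T.card : ℕ)) / ε₂) / ε₂ ^ 2 ≤ A₀) (hA₀n : (n : ℝ) ≤ A₀) (hA₀log : Real.log A₀ ≤ 101 / 100 * Real.log n) (hA₁ : 124 / 100 * Real.log n ≤ Real.log A₁) (hA₀₁ : A₀ ≤ A₁) (hPlow : A₀ ^ 2 * (n : ℝ) ^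 (-(151 / 100 : ℝ)) ≤ P * ε₁ ^ 2) (hW : 10 ^ 7 * (1 + Real.log n) ^ 2 * (Real.log (4 * ((n.factorial : ℝ) / (S.card * T.card : ℕ)) / ε₂)) ^ 2 * n * B / (ε₂ ^ 4 * h₁ ^ 2) + 20 * (1 + M) * A₀ ^ 2 * B / (h₁ ^ 2 * n) + n * P * B + 20 * (1 + M) * A₁ ^ 2 * B / (h₁ ^ 2 * n) ≤ W) (hN : W < ((S.card * T.card * U.card : ℕ) : ℝ)) (k : Fin n) (Qm : Finset (Fin n)) (σ σ' x ρ ρ' y : Fin (⌊Real.logb 2 ((n : ℝ) ^ 2)⌋₊ + 1) → ℝ) (hσ : ∀ a, σ a = ∑ j ∈ Finset.univ.filter (fun j => 16 / (n : ℝ) ≤ dB j k ∧ ⌊Real.logb 2 (1 / dB j k)⌋₊ = a.val), pB j k) (hσ' : ∀ a, σ' a = ∑ j ∈ Finset.univ.filter (fun j => 16 / (n : ℝ) ≤ dB j k ∧ ⌊Real.logb 2 (1 / dB j k)⌋₊ = a.val), dB j k) (hx : ∀ a, x a = max (((Finset.univ.filter (fun j => 16 / (n : ℝ) ≤ dB j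 k ∧ ⌊Real.logb 2 (1 / dB j k)⌋₊ = a.val)).card : ℝ)) 1) (hρ : ∀ b, ρ b = ∑ i ∈ Finset.univ.filter (fun i => i ∉ Qm ∧ θC ≤ dC k i ∧ ⌊Real.logb 2 (1 / dC k i)⌋₊ = b.val), pC k i) (hρ' : ∀ b, ρ' b = ∑ i ∈ Finset.univ.filter (fun i => i ∉ Qm ∧ θC ≤ dC k i ∧ ⌊Real.logb 2 (1 / dC k i)⌋₊ = b.val), dC k i) (hy : ∀ b, y b = max (((Finset.univ.filter (fun i => i ∉ Qm ∧ θC ≤ dC k i ∧ ⌊Real.logb 2 (1 / dC k i)⌋₊ = b.val)).card : ℝ)) 1) (Ψ : Fin (⌊Real.logb 2 ((n : ℝ) ^ 2)⌋₊ + 1) → Fin (⌊Real.logb 2 ((n : ℝ) ^ 2)⌋₊ + 1) → ℝ) (hΨ : ∀ a b, Ψ a b = ∑ i ∈ Finset.univ.filter (fun i => i ∉ Qm ∧ θC ≤ dC k i ∧ ⌊Real.logb 2 (1 / dC k i)⌋₊ = b.val), ∑ j ∈ Finset.univ.filter (fun j => 16 / (n : ℝ) ≤ dB j k ∧ ⌊Real.logb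 2 (1 / dB j k)⌋₊ = a.val), dA i j * pB j k * pC k i) : ((n : ℝ) - 1) * ∑ i ∈ Finset.univ.filter (fun i => i ∉ Qm), pC k i * ∑ j : Fin n, dB j k * (1 / n - dA i j) ≤ 5 / 8 * ((∑ a, if ε₁ ≤ σ a ∧ ∃ b, ε₁ ≤ ρ b ∧ Ψ a b ≤ (1 - ε₂) * (σ a * ρ b) / n then σ' a * (1 - Real.log (x a) / Real.log n) else 0) + (∑ b, if ε₁ ≤ ρ b ∧ ∃ a, ε₁ ≤ σ a ∧ Ψ a b ≤ (1 - ε₂) * (σ a * ρ b) / n then ρ' b * (1 - Real.log (y b) / Real.log n) else 0)) + (ε₂ * ((∑ a, σ' a) * (∑ b, ρ' b)) + 2 * ε₁ * ((⌊Real.logb 2 ((n : ℝ) ^ 2)⌋₊ + 1 : ℕ) : ℝ) * ((∑ a, σ' a) + (∑ b, ρ' b)) + 2 * ((∑ a, σ' a) + (∑ b, ρ' b)) * ((((⌊Real.logb 2 ((n : ℝ) ^ 2)⌋₊ + 1 : ℕ) : ℝ) * ((⌊Real.logb 2 ((n : ℝ) ^ 2)⌋₊ + 1 : ℕ) : ℝ))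 * h₁) + ((∑ a, σ' a) + (∑ b, ρ' b)) ^ 2 * (((⌊Real.logb 2 ((n : ℝ) ^ 2)⌋₊ + 1 : ℕ) : ℝ) * ((⌊Real.logb 2 ((n : ℝ) ^ 2)⌋₊ + 1 : ℕ) : ℝ)) / M) + (ε₂ * (∑ i ∈ Finset.univ.filter (fun i => i ∉ Qm), pC k i) + 5 * (1 + Real.log n) * ε₁ * ((∑ i ∈ Finset.univ.filter (fun i => i ∉ Qm), pC k i) + 1) + (∑ i ∈ Finset.univ.filter (fun i => i ∉ Qm), pC k i) / n) := by
  have hn0 : 0 < n := by omega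
  have hnR : (0 : ℝ) < n := by exact_mod_cast hn0
  -- (1) the heavy part `pB` of the column: the instantiated per-position bound at `θB := 16/n`
  have hinst := position_kept_bound_far_inst hn B hB hTPP hS0 hT0 hU0 dA dB dC pB pC hdA hdB hdC
    (16 / (n : ℝ)) θC le_rfl hθC hpB hpC ε₁ ε₂ h₁ M A₀ P W A₁ hε₁ hε₂ hε₂1 hh₁ hP0 hM hA₀ hA₀n hA₀log
    hA₁ hA₀₁ hPlow hW hN k Qm σ σ' x ρ ρ' y hσ hσ' hx hρ hρ' hy Ψ hΨ
  -- (2) no substantial masked S-level has a small block: the no-pinned-S-win fact (2) of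
  -- `atom_noWin_facts_masked` (`A₀² n^{-1.51} < y²`) and `32 ≤ ε₁ n^{0.245}`
  have hpow : (n : ℝ) ^ (-(151 / 100 : ℝ)) = ((n : ℝ) ^ (245 / 1000 : ℝ)) ^ 2 / (n : ℝ) ^ 2 := by
    rw [eq_div_iff (by positivity), ← Real.rpow_natCast ((n : ℝ) ^ (245 / 1000 : ℝ)) 2,
      ← Real.rpow_mul hnR.le, ← Real.rpow_natCast (n : ℝ) 2, ← Real.rpow_add hnR]
    norm_num
  have hkey : (32 * A₀ / (ε₁ * n)) ^ 2 ≤ A₀ ^ 2 * (n : ℝ) ^ (-(151 / 100 : ℝ)) := by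
    rw [hpow]
    have h1 : (32 : ℝ) ^ 2 / ε₁ ^ 2 ≤ ((n : ℝ) ^ (245 / 1000 : ℝ)) ^ 2 := by
      rw [div_le_iff₀ (pow_pos hε₁ 2)]
      calc (32 : ℝ) ^ 2 ≤ (ε₁ * (n : ℝ) ^ (245 / 1000 : ℝ)) ^ 2 :=
            pow_le_pow_left₀ (by norm_num) hε₁n 2
        _ = ((n : ℝ) ^ (245 / 1000 : ℝ)) ^ 2 * ε₁ ^ 2 := by ring
    have h2 : 0 ≤ A₀ ^ 2 / (n : ℝ) ^ 2 := by positivity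
    calc (32 * A₀ / (ε₁ * n)) ^ 2 = (32 : ℝ) ^ 2 / ε₁ ^ 2 * (A₀ ^ 2 / (n : ℝ) ^ 2) := by ring
      _ ≤ ((n : ℝ) ^ (245 / 1000 : ℝ)) ^ 2 * (A₀ ^ 2 / (n : ℝ) ^ 2) :=
          mul_le_mul_of_nonneg_right h1 h2
      _ = A₀ ^ 2 * (((n : ℝ) ^ (245 / 1000 : ℝ)) ^ 2 / (n : ℝ) ^ 2) := by ring
  have hbig : ∀ b : Fin (⌊Real.logb 2 ((n : ℝ) ^ 2)⌋₊ + 1),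
      ε₁ ≤ ∑ i ∈ Finset.univ.filter
          (fun i => i ∉ Qm ∧ θC ≤ dC k i ∧ ⌊Real.logb 2 (1 / dC k i)⌋₊ = b.val), pC k i →
        32 * A₀ / (ε₁ * n) < ((Finset.univ.filter
          (fun i => i ∉ Qm ∧ θC ≤ dC k i ∧ ⌊Real.logb 2 (1 / dC k i)⌋₊ = b.val)).card : ℝ) := by
    intro b hb
    -- the block is nonempty (its kept mass is `≥ ε₁ > 0`), so `y b` is its size
    have hne := Finset.nonempty_of_sum_ne_zero (hε₁.trans_le hb).ne'
    have hcard : (1 : ℝ) ≤ (Finset.univ.filter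
        (fun i => i ∉ Qm ∧ θC ≤ dC k i ∧ ⌊Real.logb 2 (1 / dC k i)⌋₊ = b.val)).card := by
      exact_mod_cast hne.card_pos
    have hyb := (hy b).trans (max_eq_left hcard)
    have hρb : ε₁ ≤ ρ b := by rw [hρ b]; exact hb
    have hlt := (atom_noWin_facts_masked hn B hB hTPP hS0 hT0 hU0 dA dB dC pB pC hdA hdB hdC
      (16 / (n : ℝ)) θC le_rfl hθC hpB hpC ε₁ ε₂ h₁ M A₀ P W A₁ hε₁ hε₂ hε₂1 hh₁ hP0 hM hA₀ hA₀n
      hPlow hW hN k Qm σ σ' x ρ ρ' y hσ hσ' hx hρ hρ' hy Ψ hΨ b b).2.1 hρb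
    rw [hyb] at hlt
    exact lt_of_pow_lt_pow_left₀ 2 (Nat.cast_nonneg _) (hkey.trans_lt hlt)
  -- (3) the sub-uniform part `w` of the column keeps almost nothing
  have hsub := subuniform_kept_le hn hTPP hS0 hT0 hU0 dA dB dC pC hdA hdB hdC θC hθC hpC k Qm ε₁ ε₂
    A₀ hε₁ hε₂ hε₂1 hA₀ hbig
  -- (4) `dB = pB + w` termwise, so the kept value splits into the two parts
  have hsplit : ∀ i, ∑ j : Fin n, dB j k * (1 / n - dA i j) =
      ∑ j : Fin n, pB j k * (1 / n - dA i j) +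
        ∑ j : Fin n, (if 16 / (n : ℝ) ≤ dB j k then 1 / (n : ℝ) else dB j k) * (1 / n - dA i j) := by
    intro i
    rw [← Finset.sum_add_distrib]
    refine Finset.sum_congr rfl fun j _ => ?_
    rw [← add_mul, hpB j k]
    split_ifs <;> ring
  have hK : ∑ i ∈ Finset.univ.filter (fun i => i ∉ Qm), pC k i * ∑ j : Fin n,
      pB j k * (1 / n - dA i j) = (∑ j : Fin n, pB j k) *
        (∑ i ∈ Finset.univ.filter (fun i => i ∉ Qm), pC k i) / n -
        ∑ i ∈ Finset.univ.filter (fun i => i ∉ Qm), ∑ j : Fin n, dA i j * pB j k * pC k i := by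
    rw [blockPair_kept_eq]
    ring
  have hLHS : ((n : ℝ) - 1) * ∑ i ∈ Finset.univ.filter (fun i => i ∉ Qm), pC k i *
      ∑ j : Fin n, dB j k * (1 / n - dA i j) =
      ((n : ℝ) - 1) * ∑ i ∈ Finset.univ.filter (fun i => i ∉ Qm), pC k i *
        ∑ j : Fin n, pB j k * (1 / n - dA i j) +
      ((n : ℝ) - 1) * ∑ i ∈ Finset.univ.filter (fun i => i ∉ Qm), pC k i *
        ∑ j : Fin n, (if 16 / (n : ℝ) ≤ dB j k then 1 / (n : ℝ) else dB j k) * (1 / n - dA i j) := by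
    rw [← mul_add, ← Finset.sum_add_distrib]
    congr 1
    refine Finset.sum_congr rfl fun i _ => ?_
    rw [hsplit i, mul_add]
  rw [hLHS, hK]
  exact add_le_add hinst hsub

end Summit.MatrixMultiplication.MatrixMultiplication.Theorems.PolynomialSlack
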